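import Summits.QuantumFields.QCD.Theses.PauliWegnerSea
import Literature.MathematicalPhysics.QuantumFieldTheory.QCDHeavyQuarkPropagator

/-!
# Crux `GluonicCompletion` (stmt-QuantumFields-9152), line `certified-sea-threshold-graft` — stub `stub_cutoffWindow`

H-trajectories are never lattice-massive: clause (iii) of the crux hypothesis (the LOWER fractional-moment bound)
forces every bare Wilson mass `m_crit(k) + a_k m_f/Z_m(k)` eventually below every `ε > 0`.

Proof (by contradiction).  If the bare mass of flavour `f` is `≥ ε` for infinitely many `k`, then at each
such `k`, on every torus of side `2S+1` and for every `SU(3)` field, the flavour-`f` block of the inverse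
Wilson matrix obeys the configuration-wise heavy-mass (hopping-parameter) bound
`|G_f(0, n e₀)| ≤ ε⁻¹ (4/(ε+4))^n` for `n ≤ S` (`norm_inv_wilsonDirac_apply_le`; if some other flavour
block is singular the junk inverse is `0`).  Integrating against the positive weight `|det D|` gives the
UPPER bound `(144 ε⁻¹ (4/(ε+4))^n)^s` for the phase-quenched fractional moment, while clause (iii) at
`S = n = L_k` gives the LOWER bound `c₀ e^{-C₁ a_k L_k} (L_k+1)^{-p}`; since `a_k → 0`, `L_k → ∞`
(`a_k L_k → ∞`) and `log(L_k+1) = o(L_k)`, the two are incompatible for large `k`.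
-/

noncomputable section

namespace Summit.QuantumFields.QCD.Theorems.CertifiedSeaThresholdGraft

open scoped BigOperators Topology
open MeasureTheory Filter Literature.MathematicalPhysics.QuantumFieldTheory
  Literature.MathematicalPhysics.QuantumLattice Literature.Probability.LatticeModels

/-- **Configuration-wise heavy-mass bound for one flavour of the `N_f`-flavour propagator.**  If the
bare mass of flavour `f` is `≥ ε > 0` (the other flavours arbitrary), then on the torus of side `2S+1`,
for every `SU(3)` field, the flavour-`f` entry of `(diracMatrix U mq)⁻¹` between the sites `0` and
`n e₀` (`n ≤ S`) is at most `ε⁻¹ (4/(ε+4))^n`: if all one-flavour blocks are invertible this is the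
hopping-parameter bound `norm_inv_wilsonDirac_apply_le` of the `f`-block (the inverse is flavour-diagonal,
`inv_diracMatrix_apply_same_flavour`), otherwise `det (diracMatrix U mq) = 0` and Mathlib's junk inverse
is `0`. [folklore] -/
private theorem norm_inv_diracMatrix_entry_le {Nf S : ℕ}
    (U : GaugeConfig 4 (2 * S + 1) (Matrix.specialUnitaryGroup (Fin 3) ℂ)) (mq : Fin Nf → ℝ)
    {ε : ℝ} (hε : 0 < ε) {f : Fin Nf} (hf : ε ≤ mq f) {n : ℕ} (hn : n ≤ S)
    (a b : Fin 3) (i j : Fin 4) :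
    ‖(diracMatrix U mq)⁻¹ (quarkEquiv (f, (Torus.proj (2 * S + 1) 0, a, i)))
        (quarkEquiv (f, (Torus.proj (2 * S + 1) (Pi.single 0 (n : ℤ)), b, j)))‖ ≤
      ε⁻¹ * (4 / (ε + 4)) ^ n := by
  have hθ0 : 0 ≤ 4 / (ε + 4) := by positivity
  by_cases hA : ∀ g, (wilsonDirac (fundamentalRep (Fin 3)) U (mq g) 1).det ≠ 0
  · rw [inv_diracMatrix_apply_same_flavour U mq hA]
    have hmf : 0 < mq f := hε.trans_le hf
    obtain ⟨-, hb⟩ := norm_inv_wilsonDirac_apply_le (fundamentalRep (Fin 3))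
      fundamentalRep_mem_unitaryGroup U hmf (Torus.proj (2 * S + 1) 0, a, i)
      (Torus.proj (2 * S + 1) (Pi.single 0 (n : ℤ)), b, j) 0
    refine hb.trans ?_
    rw [heavy_prefactor_eq hmf]
    have hnS : |(n : ℤ)| ≤ (S : ℤ) := by
      rw [abs_of_nonneg (Int.natCast_nonneg n)]
      exact_mod_cast hn
    have hcd : ((Torus.proj (2 * S + 1) (0 : Fin 4 → ℤ), a, i).1 0 -
        (Torus.proj (2 * S + 1) (Pi.single 0 (n : ℤ) : Fin 4 → ℤ), b, j).1 0).valMinAbs.natAbs = n := by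
      have h := natAbs_valMinAbs_neg_intCast (S := S) (n : ℤ) hnS
      rw [Int.natAbs_natCast] at h
      simpa only [Torus.proj_apply, Pi.zero_apply, Int.cast_zero, zero_sub, Pi.single_eq_same] using h
    rw [hcd]
    have hθ : 4 / (mq f + 4) ≤ 4 / (ε + 4) :=
      div_le_div_of_nonneg_left (by norm_num) (by linarith) (by linarith)
    have hθf : 0 ≤ 4 / (mq f + 4) := by positivity
    exact mul_le_mul (inv_anti₀ hε hf) (pow_le_pow_left₀ hθf hθ _) (pow_nonneg hθf _)
      (inv_nonneg.2 hε.le)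
  · obtain ⟨g, hg⟩ := not_forall.1 hA
    have hdet : (diracMatrix U mq).det = 0 := by
      rw [det_diracMatrix]
      exact Finset.prod_eq_zero (Finset.mem_univ g) (not_ne_iff.1 hg)
    rw [Matrix.nonsing_inv_apply_not_isUnit _ (by rw [hdet]; exact not_isUnit_zero), Matrix.zero_apply,
      norm_zero]
    positivity

/-- **Upper bound on the phase-quenched fractional moment in the heavy corner of one flavour.**  If the
bare mass of flavour `f` is `≥ ε > 0`, then for `n ≤ S` and `s ≥ 0` the `|det|`-reweighted Wilson average
of `(Σ_{a,i,b,j} |G_f((0,a,i),(n e₀,b,j))|)^s` on the torus of side `2S+1` is at most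
`(144 ε⁻¹ (4/(ε+4))^n)^s` (the `144` colour–spin entries are each bounded configuration-wise by
`norm_inv_diracMatrix_entry_le`; the quotient by a vanishing denominator is Lean's junk `0`). [folklore] -/
private theorem fractionalMoment_le_of_le {Nf S : ℕ} (β : ℝ) (mq : Fin Nf → ℝ) {ε : ℝ} (hε : 0 < ε)
    {f : Fin Nf} (hf : ε ≤ mq f) {n : ℕ} (hn : n ≤ S) {s : ℝ} (hs : 0 ≤ s) :
    (∫ U : GaugeConfig 4 (2 * S + 1) (Matrix.specialUnitaryGroup (Fin 3) ℂ), ‖(diracMatrix U mq).det‖ *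
        (∑ a : Fin 3, ∑ i : Fin 4, ∑ b : Fin 3, ∑ j : Fin 4,
          ‖(diracMatrix U mq)⁻¹ (quarkEquiv (f, (Torus.proj (2 * S + 1) 0, a, i)))
            (quarkEquiv (f, (Torus.proj (2 * S + 1) (Pi.single 0 (n : ℤ)), b, j)))‖) ^ s
        ∂(wilsonMeasure (fundamentalRep (Fin 3)) β)) /
      (∫ U : GaugeConfig 4 (2 * S + 1) (Matrix.specialUnitaryGroup (Fin 3) ℂ), ‖(diracMatrix U mq).det‖
        ∂(wilsonMeasure (fundamentalRep (Fin 3)) β)) ≤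
      (144 * ε⁻¹ * (4 / (ε + 4)) ^ n) ^ s := by
  set K : ℝ := ε⁻¹ * (4 / (ε + 4)) ^ n with hK
  have hK0 : 0 ≤ K := by positivity
  have hsum : ∀ U : GaugeConfig 4 (2 * S + 1) (Matrix.specialUnitaryGroup (Fin 3) ℂ),
      (∑ a : Fin 3, ∑ i : Fin 4, ∑ b : Fin 3, ∑ j : Fin 4,
        ‖(diracMatrix U mq)⁻¹ (quarkEquiv (f, (Torus.proj (2 * S + 1) 0, a, i)))
          (quarkEquiv (f, (Torus.proj (2 * S + 1) (Pi.single 0 (n : ℤ)), b, j)))‖) ≤ 144 * K := by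
    intro U
    calc _ ≤ ∑ _a : Fin 3, ∑ _i : Fin 4, ∑ _b : Fin 3, ∑ _j : Fin 4, K :=
          Finset.sum_le_sum fun a _ => Finset.sum_le_sum fun i _ => Finset.sum_le_sum fun b _ =>
            Finset.sum_le_sum fun j _ => norm_inv_diracMatrix_entry_le U mq hε hf hn a b i j
      _ = 144 * K := by simp; ring
  have h144 : (144 * ε⁻¹ * (4 / (ε + 4)) ^ n) = 144 * K := by rw [hK]; ring
  rw [h144]
  have hX : ∀ U : GaugeConfig 4 (2 * S + 1) (Matrix.specialUnitaryGroup (Fin 3) ℂ),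
      (∑ a : Fin 3, ∑ i : Fin 4, ∑ b : Fin 3, ∑ j : Fin 4,
        ‖(diracMatrix U mq)⁻¹ (quarkEquiv (f, (Torus.proj (2 * S + 1) 0, a, i)))
          (quarkEquiv (f, (Torus.proj (2 * S + 1) (Pi.single 0 (n : ℤ)), b, j)))‖) ^ s ≤
        (144 * K) ^ s := fun U =>
    Real.rpow_le_rpow (by positivity) (hsum U) hs
  have hnum : (∫ U : GaugeConfig 4 (2 * S + 1) (Matrix.specialUnitaryGroup (Fin 3) ℂ),
      ‖(diracMatrix U mq).det‖ *
        (∑ a : Fin 3, ∑ i : Fin 4, ∑ b : Fin 3, ∑ j : Fin 4,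
          ‖(diracMatrix U mq)⁻¹ (quarkEquiv (f, (Torus.proj (2 * S + 1) 0, a, i)))
            (quarkEquiv (f, (Torus.proj (2 * S + 1) (Pi.single 0 (n : ℤ)), b, j)))‖) ^ s
        ∂(wilsonMeasure (fundamentalRep (Fin 3)) β)) ≤
      (∫ U : GaugeConfig 4 (2 * S + 1) (Matrix.specialUnitaryGroup (Fin 3) ℂ), ‖(diracMatrix U mq).det‖
        ∂(wilsonMeasure (fundamentalRep (Fin 3)) β)) * (144 * K) ^ s := by
    rw [← integral_mul_const]
    refine integral_mono_of_nonneg (Eventually.of_forall fun U => ?_)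
      ((integrable_norm_det_diracMatrix mq _).mul_const _) (Eventually.of_forall fun U => ?_)
    · exact mul_nonneg (norm_nonneg _) (Real.rpow_nonneg (by positivity) _)
    · exact mul_le_mul_of_nonneg_left (hX U) (norm_nonneg _)
  have hZ0 : 0 ≤ ∫ U : GaugeConfig 4 (2 * S + 1) (Matrix.specialUnitaryGroup (Fin 3) ℂ),
      ‖(diracMatrix U mq).det‖ ∂(wilsonMeasure (fundamentalRep (Fin 3)) β) :=
    integral_nonneg fun U => norm_nonneg _
  rcases hZ0.lt_or_eq with hZ | hZ
  · rw [div_le_iff₀ hZ]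
    exact hnum.trans_eq (mul_comm _ _)
  · rw [← hZ, div_zero]
    positivity

/-- **The two bounds are asymptotically incompatible.**  For `a_k → 0`, `a_k L_k → ∞`, `0 < θ < 1`,
`A, c₀, s > 0` and any `C₁, p`: eventually `(A θ^{L_k})^s < c₀ exp(-(C₁ a_k L_k + p log(L_k+1)))`
(take logarithms: `L_k → ∞`, `C₁ a_k → 0 < s log(1/θ)`, and `log(L_k+1) = o(L_k)`). [folklore] -/
private theorem eventually_pow_rpow_lt {a : ℕ → ℝ} {L : ℕ → ℕ} (ha : Tendsto a atTop (𝓝 0))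
    (hL : Tendsto (fun k => a k * L k) atTop atTop) (C₁ p : ℝ) {s c₀ θ A : ℝ} (hs : 0 < s)
    (hc₀ : 0 < c₀) (hθ0 : 0 < θ) (hθ1 : θ < 1) (hA : 0 < A) :
    ∀ᶠ k in atTop, (A * θ ^ L k) ^ s < c₀ * Real.exp (-(C₁ * (a k * L k) + p * Real.log (L k + 1))) := by
  have hℓ : 0 < -Real.log θ := neg_pos.2 (Real.log_neg hθ0 hθ1)
  set K : ℝ := s * -Real.log θ with hK
  have hK0 : 0 < K := mul_pos hs hℓ
  have hL' : Tendsto (fun k => (L k : ℝ)) atTop atTop := by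
    refine tendsto_atTop_mono' atTop ?_ hL
    filter_upwards [ha.eventually (ge_mem_nhds one_pos)] with k hk
    exact mul_le_of_le_one_left (Nat.cast_nonneg _) hk
  have e1 : ∀ᶠ k in atTop, C₁ * a k ≤ K / 4 := by
    have h : Tendsto (fun k => C₁ * a k) atTop (𝓝 0) := by simpa using ha.const_mul C₁
    exact h.eventually (ge_mem_nhds (by positivity))
  have e2 : ∀ᶠ k in atTop, |p| * Real.log (L k + 1) ≤ K / 8 * (L k + 1) := by
    have hL1 : Tendsto (fun k => (L k : ℝ) + 1) atTop atTop := tendsto_atTop_add_const_right _ _ hL'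
    have hδ : 0 < K / 8 / (|p| + 1) := by positivity
    filter_upwards [(Real.isLittleO_log_id_atTop.comp_tendsto hL1).def hδ] with k hk
    have hL0 : (0 : ℝ) ≤ L k := Nat.cast_nonneg _
    rw [Function.comp_apply, Function.comp_apply, id, Real.norm_of_nonneg (Real.log_nonneg (by linarith)),
      Real.norm_of_nonneg (by linarith)] at hk
    calc |p| * Real.log (L k + 1) ≤ |p| * (K / 8 / (|p| + 1) * ((L k : ℝ) + 1)) :=
          mul_le_mul_of_nonneg_left hk (abs_nonneg p)
      _ = |p| / (|p| + 1) * (K / 8 * ((L k : ℝ) + 1)) := by ring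
      _ ≤ 1 * (K / 8 * ((L k : ℝ) + 1)) :=
          mul_le_mul_of_nonneg_right ((div_le_one (by positivity)).2 (by linarith)) (by positivity)
      _ = K / 8 * (L k + 1) := one_mul _
  have e3 : ∀ᶠ k in atTop, s * Real.log A - Real.log c₀ + K < K / 2 * L k :=
    (hL'.const_mul_atTop (by positivity : 0 < K / 2)).eventually_gt_atTop _
  filter_upwards [e1, e2, e3] with k h1 h2 h3
  have hL0 : (0 : ℝ) ≤ L k := Nat.cast_nonneg _
  have hKL : 0 ≤ K * L k := by positivity
  have hpos : 0 < A * θ ^ L k := by positivity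
  rw [Real.rpow_def_of_pos hpos, Real.log_mul hA.ne' (pow_pos hθ0 _).ne', Real.log_pow]
  conv_rhs => rw [← Real.exp_log hc₀, ← Real.exp_add]
  rw [Real.exp_lt_exp]
  have h1' : C₁ * (a k * L k) ≤ K / 4 * L k := by
    rw [← mul_assoc]; exact mul_le_mul_of_nonneg_right h1 hL0
  have h2' : p * Real.log (L k + 1) ≤ K / 8 * (L k + 1) :=
    (mul_le_mul_of_nonneg_right (le_abs_self p) (Real.log_nonneg (by linarith))).trans h2
  have hKs : (Real.log A + L k * Real.log θ) * s = s * Real.log A - K * L k := by rw [hK]; ring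
  rw [hKs]
  linarith

/-- **`stub_cutoffWindow` — H-trajectories are never lattice-massive.**  Along a mass-independent
regularisation `reg`, suppose clause (iii) of the crux hypothesis `H`: for every positive mass tuple `m`
the phase-quenched fractional moment of the flavour-`f` Wilson propagator between `0` and `n e₀`
(bare masses `m_crit(k) + a_k m_f/Z_m(k)`, tori of side `2S+1` with `S ≥ L_k`, `n ≤ S`) is bounded
BELOW by `c₀ e^{-C₁ a_k n} (n+1)^{-p}` eventually in `k`.  Then every bare Wilson mass
`m_crit(k) + a_k m_f/Z_m(k)` is eventually below every `ε > 0`.  Proof: otherwise `m_f(k) ≥ ε` frequently;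
at such `k` the heavy-mass hopping-parameter bound (`fractionalMoment_le_of_le`) caps the same quotient
by `(144/ε)^s (4/(ε+4))^{s n}`, and at `S = n = L_k` this contradicts the lower bound for large `k`
(`eventually_pow_rpow_lt`: `a_k → 0`, `a_k L_k → ∞`). [folklore] -/
theorem stub_cutoffWindow :
    ∀ (Nf : ℕ) (reg : QCDRegularisation Nf),
      (∀ m : Fin Nf → ℝ, (∀ f, 0 < m f) → ∃ s c₀ C₁ p : ℝ, 0 < s ∧ s < 1 ∧ 0 < c₀ ∧ ∀ᶠ k in atTop, ∀ S : ℕ, reg.L k ≤ S → ∀ (f : Fin Nf) (n : ℕ), n ≤ S → c₀ * Real.exp (-(C₁ * (reg.a k * n) + p * Real.log (n + 1))) ≤ (∫ U : GaugeConfig 4 (2 * S + 1) (Matrix.specialUnitaryGroup (Fin 3) ℂ), ‖(diracMatrix U fun fl => reg.mcrit k + reg.a k * m fl / reg.Zm k).det‖ * (∑ a : Fin 3, ∑ i : Fin 4, ∑ b : Fin 3, ∑ j : Fin 4, ‖(diracMatrix U fun fl => reg.mcrit k + reg.a k * m fl / reg.Zm k)⁻¹ (quarkEquiv (f, (Torus.proj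 (2 * S + 1) 0, a, i))) (quarkEquiv (f, (Torus.proj (2 * S + 1) (Pi.single 0 (n : ℤ)), b, j)))‖) ^ s ∂(wilsonMeasure (fundamentalRep (Fin 3)) (reg.β k))) / (∫ U : GaugeConfig 4 (2 * S + 1) (Matrix.specialUnitaryGroup (Fin 3) ℂ), ‖(diracMatrix U fun fl => reg.mcrit k + reg.a k * m fl / reg.Zm k).det‖ ∂(wilsonMeasure (fundamentalRep (Fin 3)) (reg.β k)))) →
        ∀ m : Fin Nf → ℝ, (∀ f, 0 < m f) → ∀ (f : Fin Nf) (ε : ℝ), 0 < ε →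
          ∀ᶠ k in atTop, reg.mcrit k + reg.a k * m f / reg.Zm k < ε := by
  intro Nf reg H m hm f ε hε
  obtain ⟨s, c₀, C₁, p, hs, -, hc₀, hev⟩ := H m hm
  by_contra hnot
  have hfreq : ∃ᶠ k in atTop, ε ≤ reg.mcrit k + reg.a k * m f / reg.Zm k :=
    (Filter.not_eventually.1 hnot).mono fun k hk => not_lt.1 hk
  have hθ0 : 0 < 4 / (ε + 4) := by positivity
  have hθ1 : 4 / (ε + 4) < 1 := by rw [div_lt_one (by positivity)]; linarith
  have hlt := eventually_pow_rpow_lt reg.tendsto_a reg.tendsto_L C₁ p hs hc₀ hθ0 hθ1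
    (A := 144 * ε⁻¹) (by positivity)
  obtain ⟨k, hk, hevk, hltk⟩ := (hfreq.and_eventually (hev.and hlt)).exists
  have h1 := hevk (reg.L k) le_rfl f (reg.L k) le_rfl
  have h2 := fractionalMoment_le_of_le (reg.β k) (fun fl => reg.mcrit k + reg.a k * m fl / reg.Zm k) hε
    (f := f) hk (le_refl (reg.L k)) hs.le
  linarith

end Summit.QuantumFields.QCD.Theorems.CertifiedSeaThresholdGraft

end
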